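import Summits.HodgeConjecture.HodgeConjecture.Theorems.K2E3UltrametricOrbitFiniteness   -- ★ p855343 (K2E3-p09): L6 generic — `exists_pos_forall_le_dist`, `mul_norm_proj_le_of_eq_add`, `false_of_cone_near_submodule`
import Literature.Analysis.Matrix.UltrametricElementwiseNormCalculus                      -- ★ (U): `norm_mul_le_of_isUltrametricDist` (elementwise sup norm is submultiplicative over an ultrametric field)
import Literature.LinearAlgebra.Matrix.RegularAdRangeSupCommutant                         -- ★ chart-A: `isCompl_ker_range_mulLeft_sub_mulRight_of_separable_charpoly` (`M_N = ker(ad γ) ⊕ range(ad γ)`)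
import Literature.LinearAlgebra.Matrix.NonderogatoryCommutantBaseChange                    -- ★ `minpoly_eq_charpoly_of_charpoly_separable`; brings ★ `exists_eq_aeval_of_commute_of_minpoly_eq_charpoly` (commutant `= K[γ]`)
import Mathlib.Topology.Algebra.Module.FiniteDimension
import Mathlib.Analysis.Normed.Module.FiniteDimension
import Mathlib.LinearAlgebra.Projection
import HarnessLib

/-!
# Crux `H413` — K2-LIT E3 «EllipticInputs», U12-h engine (L6-inst), FILE 1: THE REGULAR ADJOINT CONE ESTIMATES — the inputs `(hA)`, `(hcomm)`, `(hpq)` and the CONE GAP of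
# ★ L6 (`K2E3UltrametricOrbitFiniteness`) at `𝔤 = M_N(K)` with the elementwise ultrametric sup norm: `‖kXk⁻¹ − X‖ ≤ ‖k − 1‖·‖X‖`, `Ad(g)` commutes with the projection onto
# `𝔮 = range(ad γ)` along `𝔱 = ker(ad γ)` for `g` commuting with `γ`, the projection is bounded, `𝔱` has no non-zero nilpotent (`γ` with separable characteristic polynomial),
# and the nilpotent unit sphere stays at positive distance from `𝔱`

Cell `hodgecm-mathlib`, Track B «K2-LIT», crux item `stmt-HodgeConjecture-24833` (h413), line `K2_E3_EllipticInputs`, unit U12 «HC characters», socket U12-h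
`sig_K2E3CharLocConstNearRegular` (‹#9L›), depth-halving road (memo v4 `K2/K2E3-p09/g2/MEMO-U12h-HF-bricks.v4.K2E3-p09-g2.md` §2 brick (L6-inst), FREE HAND taken by seat
K2E1b-p08 (g2), K2 bus 2026-09-03T23:34Z; currency fixed by the 9L line lead K2E3-p09 (g2) 23:30:48Z); `--supports stmt-HodgeConjecture-24833 --as helper`.  THEOREMS ONLY — no `def`,
no named fact, no instance (Mathlib's SCOPED elementwise matrix norm `open scoped Matrix.Norms.Elementwise` is used, as in ★ `Literature.Analysis.Matrix.UltrametricElementwiseNormCalculus`;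
type-synonym instances are supplied inside proofs by `inferInstanceAs`), no notation, no `sorry`.  GENERIC: `K` any nontrivially normed field with `IsUltrametricDist K` (complete ∕
proper where stated; the frame brick instantiates `K := L_w`); `γ ∈ M_N(K)` with separable characteristic polynomial where stated.  FILE 2 (the UNIFORM expansion `(hT)`:
`c‖X‖ ≤ ‖(Ad(γt) − 1)X‖` on `𝔮`, `t` in a compact part of the centraliser torus) follows.  HONEST LABEL: HC_CM is proved only modulo the 7 printed citations (2 remaining named inputs:
hLiu418 = stmt-HodgeConjecture-24832, h413 = stmt-HodgeConjecture-24833) until rung 0 closes; count-neutral.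

THE MATHEMATICS [HarishChandra1999, §18 p. 79 (𝔤 = 𝔪 ⊕ 𝔮), §19 p. 81 (2)–(3), Lemma 19.3; Borel1991, I.4 (4.2, 4.4); BoschGuntzerRemmert1984, §1.2.1].
* §1 (hA) **`‖kXk⁻¹ − X‖ ≤ ‖k − 1‖·‖X‖` for `‖k⁻¹‖ ≤ 1`** (`kXk⁻¹ − X = ((k−1)X − X(k−1))k⁻¹`, ultrametric + ★ submultiplicativity) — HC's «`|(Ad(exp λ) − 1)X| ≤ |λ||X|`», the
  `δ`-smallness of `A = Ad(k) − 1` for `k ∈ K_ν` (`‖k − 1‖ ≤ q^{−ν}`, `‖k⁻¹‖ ≤ 1`).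
* §2 (hcomm) for `g` invertible COMMUTING with `γ`: `ad γ ∘ Ad(g) = Ad(g) ∘ ad γ` (`ad γ = L_γ − R_γ`), so `Ad(g)` preserves `𝔱 = ker(ad γ)` and `𝔮 = range(ad γ)` and **commutes with the
  projection `p_𝔮` onto `𝔮` along `𝔱`** (Mathlib `Submodule.projection` for the complementary pair of ★ chart-A) — used with `g = γt`, `t` in the centraliser torus.
* §3 (hpq) `∃ C ≥ 0, ‖p_𝔮 X‖ ≤ C‖X‖` (expand in the basis `E_{ij}`; any normed field).
* §4 (red) **`𝔱 ∩ 𝒩 = 0`**: a nilpotent matrix commuting with `γ` (separable `charpoly`) vanishes — it is a polynomial in `γ` (★ `exists_eq_aeval_of_commute_of_minpoly_eq_charpoly`,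
  ★ `minpoly_eq_charpoly_of_charpoly_separable`) and `minpoly γ` is squarefree hence radical (Mathlib `Squarefree.isRadical`); nilpotent `N × N` matrices satisfy `Y^N = 0`.
* §5 (gap) **`∃ ε > 0, ∀ Y nilpotent, ‖Y‖ = 1 → ∀ Z ∈ 𝔱, ε ≤ ‖Y − Z‖`** for `K` proper and complete: the nilpotent unit sphere `{Y : Y^N = 0, ‖Y‖ = 1}` is compact, `𝔱` is closed, they are
  disjoint by §4; ★ `exists_pos_forall_le_dist`.  This is the `hsep` of ★ `false_of_cone_near_submodule` (HC Lemma 19.3 with `V = ∅`: the torus case).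

## References
* [HarishChandra1999] Harish-Chandra (DeBacker–Sally), *Admissible Invariant Distributions on Reductive p-adic Groups*, ULECT 16 (1999), §18 p. 79, §19 pp. 81–84.
* [Borel1991] A. Borel, *Linear Algebraic Groups*, 2nd ed. (1991), I.4 (4.2, 4.4) (`𝔤 = ker(ad s) ⊕ range(ad s)` for semisimple `s`).
* [BoschGuntzerRemmert1984] S. Bosch, U. Güntzer, R. Remmert, *Non-Archimedean Analysis* (1984), §1.2.1 (ultrametric sup norms).
-/

set_option autoImplicit false
-- the mandated namespace repeats `HodgeConjecture.HodgeConjecture`, as in every `Theorems/*.lean` of this sub-problem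
set_option linter.dupNamespace false

noncomputable section

open scoped MatrixGroups Matrix.Norms.Elementwise
open Polynomial

namespace Summit.HodgeConjecture.HodgeConjecture.Cruxes.H413.K2E3RegularAdjointConeEstimates

/-! ## §1 (hA) The contraction `‖kXk⁻¹ − X‖ ≤ ‖k − 1‖·‖X‖` under the elementwise ultrametric norm -/

section Contraction

variable {K : Type*} [NontriviallyNormedField K] [IsUltrametricDist K] {N : ℕ}

/-- `M_N(K)` with the elementwise sup norm is ultrametric when `K` is (it is a `Pi` type; stated as a theorem, used via `haveI`).
[cite: BoschGuntzerRemmert1984, §1.2.1] -/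
theorem isUltrametricDist_matrix : IsUltrametricDist (Matrix (Fin N) (Fin N) K) :=
  inferInstanceAs (IsUltrametricDist (Fin N → Fin N → K))

omit [IsUltrametricDist K] in
/-- `kXk⁻¹ − X = ((k − 1)X − X(k − 1))·k⁻¹` in `M_N(K)`. [folklore] -/
theorem coe_mul_mul_coe_inv_sub_eq (k : GL (Fin N) K) (X : Matrix (Fin N) (Fin N) K) :
    (k : Matrix (Fin N) (Fin N) K) * X * ((k⁻¹ : GL (Fin N) K) : Matrix (Fin N) (Fin N) K) - X =
      (((k : Matrix (Fin N) (Fin N) K) - 1) * X - X * ((k : Matrix (Fin N) (Fin N) K) - 1)) * ((k⁻¹ : GL (Fin N) K) : Matrix (Fin N) (Fin N) K) := by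
  have hk : (k : Matrix (Fin N) (Fin N) K) * ((k⁻¹ : GL (Fin N) K) : Matrix (Fin N) (Fin N) K) = 1 := by rw [← Units.val_mul, mul_inv_cancel, Units.val_one]
  rw [show ((k : Matrix (Fin N) (Fin N) K) - 1) * X - X * ((k : Matrix (Fin N) (Fin N) K) - 1) = (k : Matrix (Fin N) (Fin N) K) * X - X * (k : Matrix (Fin N) (Fin N) K) by
      noncomm_ring,
    Matrix.sub_mul, Matrix.mul_assoc X, hk, Matrix.mul_one]

/-- **(hA) `‖kXk⁻¹ − X‖ ≤ ‖k − 1‖·‖X‖` when `‖k⁻¹‖ ≤ 1`** (elementwise sup norm over an ultrametric field; ★ `norm_mul_le_of_isUltrametricDist`).  For `k ∈ K_ν = 1 + ϖ^ν M_N(𝒪)`: `‖k − 1‖ ≤ q^{−ν}`,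
`‖k⁻¹‖ ≤ 1`, so `A := Ad(k) − 1` is `q^{−ν}`-small — hypothesis `hA` of ★ L6 `mul_norm_proj_le_of_eq_add`. [cite: HarishChandra1999, §19 p. 81 (2)] [cite: BoschGuntzerRemmert1984, §1.2.1] -/
theorem norm_conj_sub_le (k : GL (Fin N) K) (hk : ‖((k⁻¹ : GL (Fin N) K) : Matrix (Fin N) (Fin N) K)‖ ≤ 1) (X : Matrix (Fin N) (Fin N) K) :
    ‖(k : Matrix (Fin N) (Fin N) K) * X * ((k⁻¹ : GL (Fin N) K) : Matrix (Fin N) (Fin N) K) - X‖ ≤ ‖(k : Matrix (Fin N) (Fin N) K) - 1‖ * ‖X‖ := by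
  haveI : IsUltrametricDist (Matrix (Fin N) (Fin N) K) := isUltrametricDist_matrix
  rw [coe_mul_mul_coe_inv_sub_eq]
  have h1 : ‖((k : Matrix (Fin N) (Fin N) K) - 1) * X - X * ((k : Matrix (Fin N) (Fin N) K) - 1)‖ ≤ ‖(k : Matrix (Fin N) (Fin N) K) - 1‖ * ‖X‖ := by
    rw [sub_eq_add_neg]
    refine (IsUltrametricDist.norm_add_le_max _ _).trans (max_le ?_ ?_)
    · exact Literature.Analysis.Matrix.norm_mul_le_of_isUltrametricDist _ _
    · rw [norm_neg, mul_comm]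
      exact Literature.Analysis.Matrix.norm_mul_le_of_isUltrametricDist _ _
  calc _ ≤ ‖((k : Matrix (Fin N) (Fin N) K) - 1) * X - X * ((k : Matrix (Fin N) (Fin N) K) - 1)‖ * ‖((k⁻¹ : GL (Fin N) K) : Matrix (Fin N) (Fin N) K)‖ :=
        Literature.Analysis.Matrix.norm_mul_le_of_isUltrametricDist _ _
    _ ≤ ‖(k : Matrix (Fin N) (Fin N) K) - 1‖ * ‖X‖ * 1 := mul_le_mul h1 hk (norm_nonneg _) (mul_nonneg (norm_nonneg _) (norm_nonneg _))
    _ = ‖(k : Matrix (Fin N) (Fin N) K) - 1‖ * ‖X‖ := mul_one _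

/-- The same for `k⁻¹Xk − X` when `‖k‖ ≤ 1` (apply the previous estimate to `k⁻¹`). [cite: HarishChandra1999, §19 p. 81 (2)] -/
theorem norm_inv_conj_sub_le (k : GL (Fin N) K) (hk : ‖(k : Matrix (Fin N) (Fin N) K)‖ ≤ 1) (X : Matrix (Fin N) (Fin N) K) :
    ‖((k⁻¹ : GL (Fin N) K) : Matrix (Fin N) (Fin N) K) * X * (k : Matrix (Fin N) (Fin N) K) - X‖ ≤ ‖((k⁻¹ : GL (Fin N) K) : Matrix (Fin N) (Fin N) K) - 1‖ * ‖X‖ := by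
  have h := norm_conj_sub_le k⁻¹ (by rwa [inv_inv]) X
  rwa [inv_inv] at h

/-- For `‖k − 1‖ < 1` (e.g. `k ∈ K_ν`, `ν ≥ 1`): `‖k⁻¹ − 1‖ = ‖k − 1‖`-type symmetry is not needed; what IS needed: `‖k − 1‖ ≤ δ` and `‖k⁻¹‖ ≤ 1` ⇒ `‖kXk⁻¹ − X‖ ≤ δ‖X‖`.
[cite: HarishChandra1999, §19 p. 81 (2)] -/
theorem norm_conj_sub_le_of_le (k : GL (Fin N) K) {δ : ℝ} (hδ : ‖(k : Matrix (Fin N) (Fin N) K) - 1‖ ≤ δ) (hk : ‖((k⁻¹ : GL (Fin N) K) : Matrix (Fin N) (Fin N) K)‖ ≤ 1)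
    (X : Matrix (Fin N) (Fin N) K) : ‖(k : Matrix (Fin N) (Fin N) K) * X * ((k⁻¹ : GL (Fin N) K) : Matrix (Fin N) (Fin N) K) - X‖ ≤ δ * ‖X‖ :=
  (norm_conj_sub_le k hk X).trans (mul_le_mul_of_nonneg_right hδ (norm_nonneg _))

end Contraction

/-! ## §2 (hcomm) `Ad(g)` commutes with `ad γ`, preserves `𝔱 = ker(ad γ)`, `𝔮 = range(ad γ)`, and commutes with the projection onto `𝔮` along `𝔱` -/

section Commute

variable {K : Type*} [Field K] {N : ℕ}

/-- `ad γ (gXg⁻¹) = g (ad γ X) g⁻¹` for `g` commuting with `γ` (`ad γ = L_γ − R_γ`). [cite: Borel1991, I.4 (4.2, 4.4)] -/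
theorem ad_conj_eq (γ : Matrix (Fin N) (Fin N) K) (g : GL (Fin N) K) (hg : (g : Matrix (Fin N) (Fin N) K) * γ = γ * g) (X : Matrix (Fin N) (Fin N) K) :
    (LinearMap.mulLeft K γ - LinearMap.mulRight K γ) ((g : Matrix (Fin N) (Fin N) K) * X * ((g⁻¹ : GL (Fin N) K) : Matrix (Fin N) (Fin N) K)) =
      (g : Matrix (Fin N) (Fin N) K) * ((LinearMap.mulLeft K γ - LinearMap.mulRight K γ) X) * ((g⁻¹ : GL (Fin N) K) : Matrix (Fin N) (Fin N) K) := by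
  have h1 : ((g⁻¹ : GL (Fin N) K) : Matrix (Fin N) (Fin N) K) * (g : Matrix (Fin N) (Fin N) K) = 1 := by rw [← Units.val_mul, inv_mul_cancel, Units.val_one]
  have h2 : (g : Matrix (Fin N) (Fin N) K) * ((g⁻¹ : GL (Fin N) K) : Matrix (Fin N) (Fin N) K) = 1 := by rw [← Units.val_mul, mul_inv_cancel, Units.val_one]
  have hg' : ((g⁻¹ : GL (Fin N) K) : Matrix (Fin N) (Fin N) K) * γ = γ * ((g⁻¹ : GL (Fin N) K) : Matrix (Fin N) (Fin N) K) := by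
    calc ((g⁻¹ : GL (Fin N) K) : Matrix (Fin N) (Fin N) K) * γ
        = ((g⁻¹ : GL (Fin N) K) : Matrix (Fin N) (Fin N) K) * γ * ((g : Matrix (Fin N) (Fin N) K) * ((g⁻¹ : GL (Fin N) K) : Matrix (Fin N) (Fin N) K)) := by
          rw [h2, Matrix.mul_one]
      _ = ((g⁻¹ : GL (Fin N) K) : Matrix (Fin N) (Fin N) K) * (γ * (g : Matrix (Fin N) (Fin N) K)) * ((g⁻¹ : GL (Fin N) K) : Matrix (Fin N) (Fin N) K) := by
          simp only [Matrix.mul_assoc]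
      _ = ((g⁻¹ : GL (Fin N) K) : Matrix (Fin N) (Fin N) K) * ((g : Matrix (Fin N) (Fin N) K) * γ) * ((g⁻¹ : GL (Fin N) K) : Matrix (Fin N) (Fin N) K) := by rw [hg]
      _ = γ * ((g⁻¹ : GL (Fin N) K) : Matrix (Fin N) (Fin N) K) := by rw [← Matrix.mul_assoc, h1, Matrix.one_mul]
  simp only [LinearMap.sub_apply, LinearMap.mulLeft_apply, LinearMap.mulRight_apply, Matrix.mul_sub, Matrix.sub_mul]
  congr 1
  · -- `γ (g X g⁻¹) = g (γ X) g⁻¹`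
    rw [← Matrix.mul_assoc, ← Matrix.mul_assoc, ← hg, Matrix.mul_assoc (g : Matrix (Fin N) (Fin N) K) γ X]
  · -- `(g X g⁻¹) γ = g (X γ) g⁻¹`
    rw [Matrix.mul_assoc ((g : Matrix (Fin N) (Fin N) K) * X) ((g⁻¹ : GL (Fin N) K) : Matrix (Fin N) (Fin N) K) γ, hg', ← Matrix.mul_assoc,
      Matrix.mul_assoc (g : Matrix (Fin N) (Fin N) K) X γ]

/-- `Ad(g)` preserves `𝔱 = ker(ad γ)` for `g` commuting with `γ`. [cite: Borel1991, I.4 (4.2, 4.4)] -/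
theorem conj_mem_ker_ad (γ : Matrix (Fin N) (Fin N) K) (g : GL (Fin N) K) (hg : (g : Matrix (Fin N) (Fin N) K) * γ = γ * g) {X : Matrix (Fin N) (Fin N) K}
    (hX : X ∈ LinearMap.ker (LinearMap.mulLeft K γ - LinearMap.mulRight K γ)) :
    (g : Matrix (Fin N) (Fin N) K) * X * ((g⁻¹ : GL (Fin N) K) : Matrix (Fin N) (Fin N) K) ∈ LinearMap.ker (LinearMap.mulLeft K γ - LinearMap.mulRight K γ) := by
  rw [LinearMap.mem_ker] at hX ⊢
  rw [ad_conj_eq γ g hg, hX, Matrix.mul_zero, Matrix.zero_mul]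

/-- `Ad(g)` preserves `𝔮 = range(ad γ)` for `g` commuting with `γ`. [cite: Borel1991, I.4 (4.2, 4.4)] -/
theorem conj_mem_range_ad (γ : Matrix (Fin N) (Fin N) K) (g : GL (Fin N) K) (hg : (g : Matrix (Fin N) (Fin N) K) * γ = γ * g) {X : Matrix (Fin N) (Fin N) K}
    (hX : X ∈ LinearMap.range (LinearMap.mulLeft K γ - LinearMap.mulRight K γ)) :
    (g : Matrix (Fin N) (Fin N) K) * X * ((g⁻¹ : GL (Fin N) K) : Matrix (Fin N) (Fin N) K) ∈ LinearMap.range (LinearMap.mulLeft K γ - LinearMap.mulRight K γ) := by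
  obtain ⟨Y, rfl⟩ := LinearMap.mem_range.1 hX
  exact LinearMap.mem_range.2 ⟨(g : Matrix (Fin N) (Fin N) K) * Y * ((g⁻¹ : GL (Fin N) K) : Matrix (Fin N) (Fin N) K), ad_conj_eq γ g hg Y⟩

/-- Generic: a linear combination-free description of the projection — if `x = a + b` with `a ∈ p`, `b ∈ q` (complementary), then `p.projection q h x = a`. [folklore] -/
theorem projection_eq_of_eq_add {E : Type*} [AddCommGroup E] [Module K E] {p q : Submodule K E} (h : IsCompl p q) {x a b : E} (ha : a ∈ p) (hb : b ∈ q) (hx : x = a + b) :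
    p.projection q h x = a := by
  rw [hx, map_add, Submodule.projection_apply_of_mem_left h ha, Submodule.projection_apply_right h ⟨b, hb⟩, add_zero]

/-- **(hcomm) `Ad(g)` COMMUTES WITH THE PROJECTION `p_𝔮` onto `𝔮 = range(ad γ)` along `𝔱 = ker(ad γ)`** (`g` invertible commuting with `γ`; any complementary position of the pair):
`p_𝔮(gXg⁻¹) = g (p_𝔮 X) g⁻¹`.  With `g = γt`, `t` in the centraliser torus: hypothesis `hcomm` of ★ L6 `mul_norm_proj_le_of_eq_add` (note `Ad(γt) − 1` then also commutes).
[cite: HarishChandra1999, §18 p. 79] [cite: Borel1991, I.4 (4.2, 4.4)] -/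
theorem projection_conj_eq (γ : Matrix (Fin N) (Fin N) K)
    (h : IsCompl (LinearMap.range (LinearMap.mulLeft K γ - LinearMap.mulRight K γ)) (LinearMap.ker (LinearMap.mulLeft K γ - LinearMap.mulRight K γ)))
    (g : GL (Fin N) K) (hg : (g : Matrix (Fin N) (Fin N) K) * γ = γ * g) (X : Matrix (Fin N) (Fin N) K) :
    (LinearMap.range (LinearMap.mulLeft K γ - LinearMap.mulRight K γ)).projection (LinearMap.ker (LinearMap.mulLeft K γ - LinearMap.mulRight K γ)) h
        ((g : Matrix (Fin N) (Fin N) K) * X * ((g⁻¹ : GL (Fin N) K) : Matrix (Fin N) (Fin N) K)) =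
      (g : Matrix (Fin N) (Fin N) K) *
          (LinearMap.range (LinearMap.mulLeft K γ - LinearMap.mulRight K γ)).projection (LinearMap.ker (LinearMap.mulLeft K γ - LinearMap.mulRight K γ)) h X *
        ((g⁻¹ : GL (Fin N) K) : Matrix (Fin N) (Fin N) K) := by
  set P := (LinearMap.range (LinearMap.mulLeft K γ - LinearMap.mulRight K γ)).projection (LinearMap.ker (LinearMap.mulLeft K γ - LinearMap.mulRight K γ)) h with hP
  have hsplit : X = P X + (X - P X) := by abel
  refine projection_eq_of_eq_add h (conj_mem_range_ad γ g hg (Submodule.projection_apply_mem h X)) (conj_mem_ker_ad γ g hg (Submodule.sub_projection_mem h X)) ?_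
  conv_lhs => rw [hsplit]
  rw [Matrix.mul_add, Matrix.add_mul]

/-- `Ad(g) − 1` also commutes with `p_𝔮`: `p_𝔮 (gXg⁻¹ − X) = g (p_𝔮 X) g⁻¹ − p_𝔮 X` (the form `T ∘ pq = pq ∘ T` with `T = Ad(g) − 1`). [cite: HarishChandra1999, §18 p. 79] -/
theorem projection_conj_sub_eq (γ : Matrix (Fin N) (Fin N) K)
    (h : IsCompl (LinearMap.range (LinearMap.mulLeft K γ - LinearMap.mulRight K γ)) (LinearMap.ker (LinearMap.mulLeft K γ - LinearMap.mulRight K γ)))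
    (g : GL (Fin N) K) (hg : (g : Matrix (Fin N) (Fin N) K) * γ = γ * g) (X : Matrix (Fin N) (Fin N) K) :
    (LinearMap.range (LinearMap.mulLeft K γ - LinearMap.mulRight K γ)).projection (LinearMap.ker (LinearMap.mulLeft K γ - LinearMap.mulRight K γ)) h
        ((g : Matrix (Fin N) (Fin N) K) * X * ((g⁻¹ : GL (Fin N) K) : Matrix (Fin N) (Fin N) K) - X) =
      (g : Matrix (Fin N) (Fin N) K) *
          (LinearMap.range (LinearMap.mulLeft K γ - LinearMap.mulRight K γ)).projection (LinearMap.ker (LinearMap.mulLeft K γ - LinearMap.mulRight K γ)) h X *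
        ((g⁻¹ : GL (Fin N) K) : Matrix (Fin N) (Fin N) K) -
      (LinearMap.range (LinearMap.mulLeft K γ - LinearMap.mulRight K γ)).projection (LinearMap.ker (LinearMap.mulLeft K γ - LinearMap.mulRight K γ)) h X := by
  rw [map_sub, projection_conj_eq γ h g hg X]

/-- The complementary pair exists: for `γ` with separable characteristic polynomial over a perfect field, `range(ad γ)` and `ker(ad γ)` are complements (★ chart-A, symmetric
reading). [cite: Borel1991, I.4 (4.2, 4.4)] -/
theorem isCompl_range_ker_ad [PerfectField K] (γ : Matrix (Fin N) (Fin N) K) (hγ : γ.charpoly.Separable) :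
    IsCompl (LinearMap.range (LinearMap.mulLeft K γ - LinearMap.mulRight K γ)) (LinearMap.ker (LinearMap.mulLeft K γ - LinearMap.mulRight K γ)) :=
  (Literature.LinearAlgebra.Matrix.isCompl_ker_range_mulLeft_sub_mulRight_of_separable_charpoly γ hγ).symm

end Commute

/-! ## §3 (hpq) The projection is bounded -/

section Bounded

variable {K : Type*} [NontriviallyNormedField K] {N : ℕ}

/-- **(hpq) `∃ C ≥ 0, ∀ X, ‖P X‖ ≤ C‖X‖` for ANY linear endomorphism `P` of `M_N(K)`** (elementwise norm): expand `X = Σ X_{ij} E_{ij}`, so `‖P X‖ ≤ Σ ‖X_{ij}‖‖P E_{ij}‖ ≤ (Σ ‖P E_{ij}‖)‖X‖`.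
Used with `P = p_𝔮`. [cite: BoschGuntzerRemmert1984, §1.2.1] -/
theorem exists_bound_of_linearMap (P : Matrix (Fin N) (Fin N) K →ₗ[K] Matrix (Fin N) (Fin N) K) :
    ∃ C : ℝ, 0 ≤ C ∧ ∀ X : Matrix (Fin N) (Fin N) K, ‖P X‖ ≤ C * ‖X‖ := by
  classical
  refine ⟨∑ i : Fin N, ∑ j : Fin N, ‖P (Matrix.single i j 1)‖, Finset.sum_nonneg fun i _ => Finset.sum_nonneg fun j _ => norm_nonneg _, fun X => ?_⟩
  have hX : X = ∑ i : Fin N, ∑ j : Fin N, X i j • Matrix.single i j (1 : K) := by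
    conv_lhs => rw [Matrix.matrix_eq_sum_single X]
    refine Finset.sum_congr rfl fun i _ => Finset.sum_congr rfl fun j _ => ?_
    rw [Matrix.smul_single, smul_eq_mul, mul_one]
  calc ‖P X‖ = ‖∑ i : Fin N, ∑ j : Fin N, X i j • P (Matrix.single i j 1)‖ := by
        conv_lhs => rw [hX]
        simp only [map_sum, map_smul]
    _ ≤ ∑ i : Fin N, ‖∑ j : Fin N, X i j • P (Matrix.single i j 1)‖ := norm_sum_le _ _
    _ ≤ ∑ i : Fin N, ∑ j : Fin N, ‖X i j • P (Matrix.single i j 1)‖ := Finset.sum_le_sum fun i _ => norm_sum_le _ _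
    _ ≤ ∑ i : Fin N, ∑ j : Fin N, ‖P (Matrix.single i j 1)‖ * ‖X‖ := by
        refine Finset.sum_le_sum fun i _ => Finset.sum_le_sum fun j _ => ?_
        rw [norm_smul, mul_comm]
        exact mul_le_mul_of_nonneg_left (Matrix.norm_entry_le_entrywise_sup_norm X) (norm_nonneg _)
    _ = (∑ i : Fin N, ∑ j : Fin N, ‖P (Matrix.single i j 1)‖) * ‖X‖ := by
        rw [Finset.sum_mul]; refine Finset.sum_congr rfl fun i _ => ?_; rw [Finset.sum_mul]

end Bounded

/-! ## §4 (red) `𝔱 = ker(ad γ)` contains no non-zero nilpotent -/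

section Reduced

variable {K : Type*} [Field K] {N : ℕ}

/-- An `N × N` nilpotent matrix satisfies `Y^N = 0` (Cayley–Hamilton: the characteristic polynomial of a nilpotent endomorphism is `X^N`, Mathlib `isNilpotent_iff_charpoly`). [folklore] -/
theorem pow_card_eq_zero_of_isNilpotent {Y : Matrix (Fin N) (Fin N) K} (hY : IsNilpotent Y) : Y ^ N = 0 := by
  have h1 : Y.charpoly = X ^ N := by
    have h := (Matrix.isNilpotent_charpoly_sub_pow_of_isNilpotent hY).eq_zero
    rw [sub_eq_zero, Fintype.card_fin] at h
    exact h
  have h2 := Matrix.aeval_self_charpoly Y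
  rwa [h1, map_pow, aeval_X] at h2

/-- **(red) A NILPOTENT MATRIX COMMUTING WITH `γ` (separable characteristic polynomial) IS ZERO**: it is `p(γ)` for a polynomial `p` (★ `exists_eq_aeval_of_commute_of_minpoly_eq_charpoly` with ★
`minpoly_eq_charpoly_of_charpoly_separable`), `p(γ)^m = 0` ⇒ `minpoly γ ∣ p^m` ⇒ (`minpoly γ = charpoly γ` separable, hence squarefree, hence radical — Mathlib `Squarefree.isRadical`)
`minpoly γ ∣ p` ⇒ `p(γ) = 0`.  So `𝔱 = Z_𝔤(γ) = K[γ]` has no non-zero nilpotent: the torus case `𝒩 ∩ 𝔪 = {0}` of HC1999 Lemma 19.3 (`V = ∅`). [cite: HarishChandra1999, Lemma 19.3 p. 82] [cite: Borel1991, I.4 (4.4)] -/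
theorem eq_zero_of_isNilpotent_of_commute (γ : Matrix (Fin N) (Fin N) K) (hγ : γ.charpoly.Separable) {Y : Matrix (Fin N) (Fin N) K} (hY : IsNilpotent Y) (hc : Commute γ Y) :
    Y = 0 := by
  have hmin := Literature.LinearAlgebra.Matrix.minpoly_eq_charpoly_of_charpoly_separable γ hγ
  obtain ⟨p, -, hp⟩ := Literature.LinearAlgebra.Matrix.exists_eq_aeval_of_commute_of_minpoly_eq_charpoly γ Y hmin hc
  obtain ⟨m, hm⟩ := hY
  have hdvd : minpoly K γ ∣ p ^ m := minpoly.dvd K γ (by rw [map_pow, ← hp, hm])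
  have hrad : IsRadical (minpoly K γ) := (hmin ▸ hγ.squarefree).isRadical
  obtain ⟨r, hr⟩ := hrad m p hdvd
  rw [hp, hr, map_mul, minpoly.aeval, zero_mul]

/-- The same with membership in `ker(ad γ)` (`ad γ = L_γ − R_γ`) as the commuting hypothesis. [cite: HarishChandra1999, Lemma 19.3 p. 82] -/
theorem eq_zero_of_isNilpotent_of_mem_ker_ad (γ : Matrix (Fin N) (Fin N) K) (hγ : γ.charpoly.Separable) {Y : Matrix (Fin N) (Fin N) K} (hY : IsNilpotent Y)
    (hmem : Y ∈ LinearMap.ker (LinearMap.mulLeft K γ - LinearMap.mulRight K γ)) : Y = 0 := by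
  refine eq_zero_of_isNilpotent_of_commute γ hγ hY ?_
  rw [LinearMap.mem_ker, LinearMap.sub_apply, LinearMap.mulLeft_apply, LinearMap.mulRight_apply, sub_eq_zero] at hmem
  exact hmem

end Reduced

/-! ## §5 (gap) The nilpotent unit sphere stays at positive distance from `𝔱` -/

section Gap

variable {K : Type*} [NontriviallyNormedField K] [CompleteSpace K] [ProperSpace K] {N : ℕ}

omit [CompleteSpace K] [ProperSpace K] in
/-- The set `{Y : Y^N = 0}` of nilpotent matrices is closed (elementwise norm topology = product topology; `Y ↦ Y^N` is continuous). [folklore] -/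
theorem isClosed_setOf_pow_eq_zero : IsClosed {Y : Matrix (Fin N) (Fin N) K | Y ^ N = 0} :=
  isClosed_eq (continuous_id.pow N) continuous_const

/-- **(gap) THE CONE GAP**: for `γ` with separable characteristic polynomial, `∃ ε > 0, ∀ Y nilpotent with ‖Y‖ = 1, ∀ Z ∈ 𝔱 = ker(ad γ), ε ≤ ‖Y − Z‖` — the nilpotent unit sphere is compact
(`K` proper), `𝔱` is closed, and they are disjoint by §4; ★ `exists_pos_forall_le_dist`.  This is the `hsep` of ★ L6 `false_of_cone_near_submodule` with `𝒩 = {nilpotent}`.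
[cite: HarishChandra1999, Lemma 19.3 pp. 82–84] -/
theorem exists_pos_forall_le_norm_sub_of_isNilpotent (γ : Matrix (Fin N) (Fin N) K) (hγ : γ.charpoly.Separable) :
    ∃ ε : ℝ, 0 < ε ∧ ∀ Y : Matrix (Fin N) (Fin N) K, IsNilpotent Y → ‖Y‖ = 1 →
      ∀ Z ∈ LinearMap.ker (LinearMap.mulLeft K γ - LinearMap.mulRight K γ), ε ≤ ‖Y - Z‖ := by
  haveI : ProperSpace (Matrix (Fin N) (Fin N) K) := inferInstanceAs (ProperSpace (Fin N → Fin N → K))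
  -- the compact nilpotent unit sphere
  have hKc : IsCompact ({Y : Matrix (Fin N) (Fin N) K | Y ^ N = 0} ∩ Metric.sphere (0 : Matrix (Fin N) (Fin N) K) 1) :=
    (isCompact_sphere (0 : Matrix (Fin N) (Fin N) K) 1).of_isClosed_subset (isClosed_setOf_pow_eq_zero.inter Metric.isClosed_sphere) Set.inter_subset_right
  -- the closed subspace `𝔱`
  have hC : IsClosed (LinearMap.ker (LinearMap.mulLeft K γ - LinearMap.mulRight K γ) : Set (Matrix (Fin N) (Fin N) K)) :=
    Submodule.closed_of_finiteDimensional _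
  have hdisj : Disjoint ({Y : Matrix (Fin N) (Fin N) K | Y ^ N = 0} ∩ Metric.sphere (0 : Matrix (Fin N) (Fin N) K) 1)
      (LinearMap.ker (LinearMap.mulLeft K γ - LinearMap.mulRight K γ) : Set (Matrix (Fin N) (Fin N) K)) := by
    refine Set.disjoint_left.2 fun Y hY hYker => ?_
    have h0 : Y = 0 := eq_zero_of_isNilpotent_of_mem_ker_ad γ hγ ⟨N, hY.1⟩ hYker
    have h1 : ‖Y‖ = 1 := by simpa using hY.2
    rw [h0, norm_zero] at h1
    exact zero_ne_one h1
  obtain ⟨ε, hε, h⟩ := K2E3UltrametricOrbitFiniteness.exists_pos_forall_le_dist hKc hC hdisj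
  refine ⟨ε, hε, fun Y hY hY1 Z hZ => ?_⟩
  have hmem : Y ∈ {Y : Matrix (Fin N) (Fin N) K | Y ^ N = 0} ∩ Metric.sphere (0 : Matrix (Fin N) (Fin N) K) 1 :=
    ⟨pow_card_eq_zero_of_isNilpotent hY, by simpa using hY1⟩
  have := h Y hmem Z hZ
  rwa [dist_eq_norm] at this

end Gap

end Summit.HodgeConjecture.HodgeConjecture.Cruxes.H413.K2E3RegularAdjointConeEstimates

end
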